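import Summits.NavierStokesRegularity.NavierStokesRegularity.Theorems.LevelSetModerationIterationLemma

/-!
# Route LevelSetModeration — crux `LevelSetClosure`: Stampacchia's extinction lemma (stub S5)

Support file for item stmt-NavierStokesRegularity-18150 (line `Sketch-ideator2`, stub
`stub_stampacchia`). Stampacchia's extinction lemma (Kinderlehrer–Stampacchia, Ch. II,
Lemma B.1), the real-variable engine of the De Giorgi iteration: a nonnegative nonincreasing
`φ` on `[k₀, ∞)` with the two-level gain `φ(h) ≤ C (h-k)^{-α} φ(k)^β`, `β > 1`, VANISHES at the
finite level `k₀ + d` as soon as `d^α ≥ C φ(k₀)^{β-1} 2^{αβ/(β-1)}`.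

Proof: evaluate the two-level gain at the dyadic levels `c_j = k₀ + d(1 - 2^{-j})`, normalise
`W_j = L φ(c_j)` with `L^{β-1} = C d^{-α}`, run the landed `IterationLemma`
(`iterationLemma_proof`) with constant `2^α`, and pass to the limit by monotonicity.
-/

noncomputable section

-- single-conjunct summit: `Summit.<Summit>.<Problem>` repeats the name by the D-0017 layout
set_option linter.dupNamespace false

namespace Summit.NavierStokesRegularity.NavierStokesRegularity.Theorems.LevelSetClosure

open Set Filter Topology

-- adapted from Cruxes/LevelSetClosure/SketchIdeator2.lean (crux-ideate r1 k2)

/-- An elementary identity used below: `((1/2)^n)^α = ((2^α)⁻¹)^n`. -/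
private theorem half_pow_rpow (α : ℝ) : ∀ n : ℕ, (((2:ℝ)⁻¹) ^ n) ^ α = (((2:ℝ) ^ α)⁻¹) ^ n := by
  intro n
  induction n with
  | zero => simp
  | succ n ih =>
      rw [pow_succ, Real.mul_rpow (by positivity) (by positivity), ih, pow_succ,
        Real.inv_rpow (by positivity)]

/-- **Stampacchia's extinction lemma** (Kinderlehrer–Stampacchia, Ch. II, Lemma B.1), from the
landed `IterationLemma`: a nonnegative nonincreasing `φ` on `[k₀, ∞)` with the two-level gain
`φ(h) ≤ C (h-k)^{-α} φ(k)^β` (`β > 1`) on `[k₀, k₀ + d]` and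
`C φ(k₀)^{β-1} 2^{αβ/(β-1)} ≤ d^α` satisfies `φ(k₀ + d) = 0`. -/
theorem stub_stampacchia :
    ∀ (φ : ℝ → ℝ) (k₀ d C α β : ℝ), 0 < C → 0 < α → 1 < β → 0 < d →
      (∀ h, k₀ ≤ h → 0 ≤ φ h) → AntitoneOn φ (Set.Ici k₀) →
      (∀ k h, k₀ ≤ k → k < h → h ≤ k₀ + d → φ h ≤ C / (h - k) ^ α * φ k ^ β) →
      C * φ k₀ ^ (β - 1) * 2 ^ (α * β / (β - 1)) ≤ d ^ α → φ (k₀ + d) = 0 := by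
  intro φ k₀ d C α β hC hα hβ hd hφ0 hanti hrec hsize
  -- the landed iteration lemma, unfolded
  have hI : ∀ (C β : ℝ), 1 < C → 1 < β → ∀ (W : ℕ → ℝ), (∀ k, 0 ≤ W k) →
      (∀ k, W (k + 1) ≤ C ^ (k + 1) * (W k) ^ β) → W 0 ≤ C ^ (-(β / (β - 1) ^ 2)) →
      Tendsto W atTop (nhds 0) :=
    Summit.NavierStokesRegularity.NavierStokesRegularity.Theorems.iterationLemma_proof
  -- dyadic levels
  set c : ℕ → ℝ := fun j => k₀ + d * (1 - (2:ℝ)⁻¹ ^ j) with hc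
  have hc_ge : ∀ j, k₀ ≤ c j := fun j => by
    have : (2:ℝ)⁻¹ ^ j ≤ 1 := pow_le_one₀ (by norm_num) (by norm_num)
    simp only [hc]; nlinarith
  have hc_le : ∀ j, c j ≤ k₀ + d := fun j => by
    have : 0 ≤ (2:ℝ)⁻¹ ^ j := by positivity
    simp only [hc]; nlinarith
  have hgap : ∀ j, c (j + 1) - c j = d * (2:ℝ)⁻¹ ^ (j + 1) := fun j => by
    simp only [hc, pow_succ]; ring
  have hc_lt : ∀ j, c j < c (j + 1) := fun j => by
    have h := hgap j
    have : 0 < d * (2:ℝ)⁻¹ ^ (j + 1) := by positivity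
    linarith
  -- the normalising constant `L = (C / d^α)^{1/(β-1)}`
  have hβ1 : 0 < β - 1 := by linarith
  have hdα : 0 < d ^ α := Real.rpow_pos_of_pos hd α
  have hCd : 0 < C / d ^ α := div_pos hC hdα
  set L : ℝ := (C / d ^ α) ^ (1 / (β - 1)) with hL
  have hLpos : 0 < L := Real.rpow_pos_of_pos hCd _
  have hLpow : L ^ (β - 1) = C / d ^ α := by
    rw [hL, ← Real.rpow_mul hCd.le, one_div_mul_cancel hβ1.ne', Real.rpow_one]
  have hLβ : L ^ β = L * (C / d ^ α) := by
    rw [show β = 1 + (β - 1) by ring, Real.rpow_add hLpos, Real.rpow_one, hLpow]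
  have h2α : (0:ℝ) < (2:ℝ) ^ α := Real.rpow_pos_of_pos (by norm_num) α
  have h2αne : (2:ℝ) ^ α ≠ 0 := h2α.ne'
  have hdαne : d ^ α ≠ 0 := hdα.ne'
  -- the normalised sequence and its recurrence
  set W : ℕ → ℝ := fun j => L * φ (c j) with hW
  have hW0 : ∀ j, 0 ≤ W j := fun j => mul_nonneg hLpos.le (hφ0 _ (hc_ge j))
  have hWrec : ∀ j, W (j + 1) ≤ ((2:ℝ) ^ α) ^ (j + 1) * W j ^ β := by
    intro j
    have hφj : 0 ≤ φ (c j) := hφ0 _ (hc_ge j)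
    have h1 := hrec (c j) (c (j + 1)) (hc_ge j) (hc_lt j) (hc_le (j + 1))
    rw [hgap, Real.mul_rpow hd.le (by positivity), half_pow_rpow] at h1
    have hq : 0 < (((2:ℝ) ^ α)⁻¹) ^ (j + 1) := by positivity
    calc W (j + 1) = L * φ (c (j + 1)) := rfl
      _ ≤ L * (C / (d ^ α * (((2:ℝ) ^ α)⁻¹) ^ (j + 1)) * φ (c j) ^ β) :=
          mul_le_mul_of_nonneg_left h1 hLpos.le
      _ = ((2:ℝ) ^ α) ^ (j + 1) * W j ^ β := by
          have hpne : ((2:ℝ) ^ α) ^ (j + 1) ≠ 0 := pow_ne_zero _ h2αne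
          simp only [hW]
          rw [Real.mul_rpow hLpos.le hφj, hLβ, inv_pow]
          field_simp
  -- the threshold: `W 0 ≤ (2^α)^{-(β/(β-1)²)}`
  have hx0 : 0 ≤ φ k₀ := hφ0 _ le_rfl
  have hβ1ne : β - 1 ≠ 0 := hβ1.ne'
  have hstart : W 0 ≤ ((2:ℝ) ^ α) ^ (-(β / (β - 1) ^ 2)) := by
    have hP0 : (0:ℝ) < (2:ℝ) ^ (α * β / (β - 1)) := Real.rpow_pos_of_pos (by norm_num) _
    have h1 : φ k₀ ^ (β - 1) ≤ d ^ α / (C * (2:ℝ) ^ (α * β / (β - 1))) := by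
      rw [le_div_iff₀ (by positivity)]
      calc φ k₀ ^ (β - 1) * (C * (2:ℝ) ^ (α * β / (β - 1)))
          = C * φ k₀ ^ (β - 1) * (2:ℝ) ^ (α * β / (β - 1)) := by ring
        _ ≤ d ^ α := hsize
    have h2 : φ k₀ ≤ (d ^ α / (C * (2:ℝ) ^ (α * β / (β - 1)))) ^ (1 / (β - 1)) := by
      have h := Real.rpow_le_rpow (Real.rpow_nonneg hx0 _) h1 (le_of_lt (one_div_pos.2 hβ1))
      rwa [← Real.rpow_mul hx0, mul_one_div_cancel hβ1ne, Real.rpow_one] at h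
    have hP : ((2:ℝ) ^ (α * β / (β - 1)))⁻¹ = (2:ℝ) ^ (-(α * β / (β - 1))) := by
      rw [Real.rpow_neg (show (0:ℝ) ≤ 2 by norm_num)]
    have hLinv : L⁻¹ = (d ^ α / C) ^ (1 / (β - 1)) := by
      rw [hL, ← Real.inv_rpow hCd.le, inv_div]
    have hexp : -(α * β / (β - 1)) * (1 / (β - 1)) = α * -(β / (β - 1) ^ 2) := by
      field_simp
    have h3 : (d ^ α / (C * (2:ℝ) ^ (α * β / (β - 1)))) ^ (1 / (β - 1)) =
        L⁻¹ * ((2:ℝ) ^ α) ^ (-(β / (β - 1) ^ 2)) := by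
      rw [div_mul_eq_div_div, div_eq_mul_inv (d ^ α / C),
        Real.mul_rpow (by positivity) (by positivity), ← hLinv, hP,
        ← Real.rpow_mul (show (0:ℝ) ≤ 2 by norm_num),
        ← Real.rpow_mul (show (0:ℝ) ≤ 2 by norm_num), hexp]
    rw [h3] at h2
    have hW0' : W 0 = L * φ k₀ := by simp [hW, hc]
    rw [hW0']
    calc L * φ k₀ ≤ L * (L⁻¹ * ((2:ℝ) ^ α) ^ (-(β / (β - 1) ^ 2))) :=
          mul_le_mul_of_nonneg_left h2 hLpos.le
      _ = ((2:ℝ) ^ α) ^ (-(β / (β - 1) ^ 2)) := by rw [mul_inv_cancel_left₀ hLpos.ne']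
  -- run the iteration lemma
  have h2α1 : (1:ℝ) < (2:ℝ) ^ α := Real.one_lt_rpow (by norm_num) hα
  have hlim : Tendsto W atTop (nhds 0) := hI _ _ h2α1 hβ W hW0 hWrec hstart
  have hlimφ : Tendsto (fun j => φ (c j)) atTop (nhds 0) := by
    have h := hlim.const_mul L⁻¹
    rw [mul_zero] at h
    refine h.congr' (Eventually.of_forall fun j => ?_)
    show L⁻¹ * W j = φ (c j)
    simp only [hW]
    exact inv_mul_cancel_left₀ hLpos.ne' _
  -- monotone passage to the limit
  have hle : ∀ j, φ (k₀ + d) ≤ φ (c j) := fun j =>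
    hanti (hc_ge j) (show k₀ + d ∈ Ici k₀ from by simp [hd.le]) (hc_le j)
  have hge : 0 ≤ φ (k₀ + d) := hφ0 _ (by linarith)
  have : φ (k₀ + d) ≤ 0 := ge_of_tendsto' hlimφ hle
  linarith

end Summit.NavierStokesRegularity.NavierStokesRegularity.Theorems.LevelSetClosure
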